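import Literature.RepresentationTheory.HeisenbergGroup.DualLatticePair
import Mathlib.Topology.Algebra.RestrictedProduct.TopologicalSpace
import Mathlib.Topology.Algebra.RestrictedProduct.Units
import Mathlib.Algebra.BigOperators.Finprod
import HarnessLib

/-!
# Restricted products of rank-one dual lattice pairs: the finite-adelic character `∏_v ψ_v` and its dual lattice pair
# `(∏_v C₁ᵛ, ∏_v C₂ᵛ)` from local pairs that are `(A_v, A_v)` at almost every place

Topic `RepresentationTheory/HeisenbergGroup`; namespace `Literature.RepresentationTheory.HeisenbergGroup`.  KERNEL ONLY:
two definitions with bodies (`RestrictedPair.box`, `RestrictedPair.prodChar`) and proved theorems; no named fact, no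
record, no `sorry`.

[Weil1964, Chap. III n° 37–39] (the adelic Heisenberg group as a restricted product with respect to the `X_v°`,
characters `χ = ∏_v χ_v` trivial on `X_v°` for almost all `v`, the lattice `∏_v X_v°`); [Tate1950 §3 / Bump1997 §3.1]
(the adelic character `ψ = ∏ ψ_v`).  For a restricted product `P = Πʳ i, [R i, A i]` of commutative topological rings
`R i` with respect to open subrings `A i` (Mathlib's `RestrictedProduct`, e.g. `𝐀_fin = Πʳ_v [F_v, 𝒪_v]`) and
characters `ψ i` of `R i` trivial on `A i` for almost all `i`:

* §1 **`box C`**: the additive subgroup `{x ; ∀ i, x i ∈ C i}` of `P` for a family of additive subgroups `C i ≤ R i`;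
  **`prodChar ψ`**: the character `x ↦ ∏_i ψ_i(x_i)` of `P` (a finite product for each `x`: `x_i ∈ A_i ⊆ ker ψ_i` for
  almost all `i`; Mathlib `finprod`), `prodChar_single`, multiplicativity;
* §2 topology of boxes: `isOpen_box` (each `C i` open, `C i = A i` for almost all `i`), `isCompact_box` (each `C i`
  compact, `C i = A i` a.e.: the box is the continuous image of `∏ i, C i`);
* §3 **`isDualLatticePair_box`**: if `(C₁ⁱ, C₂ⁱ)` is a dual lattice pair for `(s, t) ↦ ψ_i(s t)` at every `i`, with
  `C₁ⁱ = A i = C₂ⁱ` for almost all `i`, then `(box C₁, box C₂)` is a dual lattice pair for `(x, y) ↦ (∏ψ)(x y)` on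
  `P × P` — duality tested on the elements `single i a` supported at one place;
* §4 **`exists_units_smul_box_subset`**: if at every `i` the unit scalings of `C i` shrink to `0`, the unit scalings of
  `box C` shrink to `0` in `P` (a unit of `P` that is a suitable `u_i` at finitely many places and `1` elsewhere).

With `DualLatticePairNonarchRankOne.lean` (the local pairs `(𝒪_v, 𝔠_v)`), `DualLatticePairPi.lean` (boxes `Cⁿ`) and
`StoneVonNeumannLatticePair.lean` / `HeisenbergPairUniqueness.lean` this makes the finite-adelic input of the global
uniqueness of `ρ_ψ` a statement about LOCAL characters only.  Nothing of the cited sources is asserted.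

## References
* [Weil1964] A. Weil, Acta Math. 111 (1964), Chap. III n° 37–39.
* [Bump1997] D. Bump, *Automorphic Forms and Representations*, CUP (1997), §3.1 (adeles, `ψ = ∏ ψ_v`).
-/

set_option autoImplicit false

noncomputable section

open Set Filter Topology Function
open scoped Pointwise RestrictedProduct

namespace Literature.RepresentationTheory.HeisenbergGroup

namespace RestrictedPair

variable {ι : Type*} {R : ι → Type*} [∀ i, CommRing (R i)] {S : ι → Type*} [∀ i, SetLike (S i) (R i)]
  [∀ i, SubringClass (S i) (R i)] {A : ∀ i, S i}

/-! ## §1 Boxes and the product character -/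

/-- **the box `∏_i C_i`** inside the restricted product: `{x ; ∀ i, x i ∈ C i}` (it lies in `Πʳ i, [R i, A i]` as soon as
`C i ⊆ A i` for almost all `i`; as an additive subgroup no such condition is needed). [cite: Weil1964, Chap. III n° 37] -/
def box (C : ∀ i, AddSubgroup (R i)) : AddSubgroup (Πʳ i, [R i, A i]) where
  carrier := {x | ∀ i, x i ∈ C i}
  add_mem' {x} {y} hx hy i := by
    rw [RestrictedProduct.add_apply]
    exact (C i).add_mem (hx i) (hy i)
  zero_mem' i := by
    rw [RestrictedProduct.zero_apply]
    exact (C i).zero_mem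
  neg_mem' {x} hx i := by
    rw [RestrictedProduct.neg_apply]
    exact (C i).neg_mem (hx i)

/-- membership in a box. [cite: Weil1964, Chap. III n° 37] -/
theorem mem_box {C : ∀ i, AddSubgroup (R i)} {x : Πʳ i, [R i, A i]} : x ∈ box (A := A) C ↔ ∀ i, x i ∈ C i := Iff.rfl

variable (ψ : ∀ i, AddChar (R i) Circle) (hψ : ∀ᶠ i in cofinite, ∀ a ∈ A i, ψ i a = 1)
include hψ

omit [∀ i, SubringClass (S i) (R i)] in
/-- for `x` in the restricted product, `ψ_i(x_i) = 1` for almost all `i` (those with `x_i ∈ A_i ⊆ ker ψ_i`).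
[cite: Weil1964, Chap. III n° 38] -/
theorem hasFiniteMulSupport_apply (x : Πʳ i, [R i, A i]) : HasFiniteMulSupport fun i => ψ i (x i) := by
  have h1 : {i | ¬ (x i ∈ (A i : Set (R i)))}.Finite := Filter.eventually_cofinite.1 x.2
  have h2 : {i | ¬ (∀ a ∈ A i, ψ i a = 1)}.Finite := Filter.eventually_cofinite.1 hψ
  refine (h1.union h2).subset fun i hi => ?_
  by_contra hn
  rw [Set.mem_union, Set.mem_setOf_eq, Set.mem_setOf_eq, not_or, not_not, not_not] at hn
  exact hi (hn.2 _ hn.1)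

/-- **the product character `x ↦ ∏_i ψ_i(x_i)`** of the restricted product (a finite product for each `x`).
[cite: Weil1964, Chap. III n° 38] -/
def prodChar : AddChar (Πʳ i, [R i, A i]) Circle where
  toFun x := ∏ᶠ i, ψ i (x i)
  map_zero_eq_one' := by
    simp only [RestrictedProduct.zero_apply, AddChar.map_zero_eq_one, finprod_one]
  map_add_eq_mul' x y := by
    simp only [RestrictedProduct.add_apply, AddChar.map_add_eq_mul]
    exact finprod_mul_distrib (hasFiniteMulSupport_apply ψ hψ x) (hasFiniteMulSupport_apply ψ hψ y)

/-- unfolding. [cite: Weil1964, Chap. III n° 38] -/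
theorem prodChar_apply (x : Πʳ i, [R i, A i]) : prodChar ψ hψ x = ∏ᶠ i, ψ i (x i) := rfl

/-- if every local factor is `1` the product character is `1`. [cite: Weil1964, Chap. III n° 38] -/
theorem prodChar_eq_one_of_forall {x : Πʳ i, [R i, A i]} (h : ∀ i, ψ i (x i) = 1) : prodChar ψ hψ x = 1 := by
  rw [prodChar_apply]
  exact finprod_eq_one_of_forall_eq_one h

/-- on an element supported at one place the product character is the local character:
`(∏ψ)(x) = ψ_i(x_i)` when `x_j = 0` for `j ≠ i`. [cite: Weil1964, Chap. III n° 38] -/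
theorem prodChar_eq_of_forall_ne {x : Πʳ i, [R i, A i]} (i : ι) (h : ∀ j, j ≠ i → x j = 0) :
    prodChar ψ hψ x = ψ i (x i) := by
  rw [prodChar_apply]
  exact finprod_eq_single (fun j => ψ j (x j)) i fun j hj => by rw [h j hj, AddChar.map_zero_eq_one]

/-- the product character on `single i a`. [cite: Weil1964, Chap. III n° 38] -/
theorem prodChar_single [DecidableEq ι] (i : ι) (a : R i) :
    prodChar ψ hψ (RestrictedProduct.single A i a) = ψ i a := by
  rw [prodChar_eq_of_forall_ne ψ hψ i fun j hj => RestrictedProduct.single_eq_of_ne A a hj,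
    RestrictedProduct.single_eq_same A i a]

/-! ## §2 Topology of boxes -/

section Topology

variable [∀ i, TopologicalSpace (R i)]

omit [∀ i, SubringClass (S i) (R i)] hψ in
/-- **a box is open** when every `C i` is open and `C i = A i` for almost all `i`: it is the open set
`{f ; f i ∈ A i off T}` cut by finitely many open coordinate conditions. [cite: Weil1964, Chap. III n° 37] -/
theorem isOpen_box [∀ i, SubringClass (S i) (R i)] (C : ∀ i, AddSubgroup (R i))
    (hAopen : ∀ i, IsOpen (A i : Set (R i))) (hCo : ∀ i, IsOpen (C i : Set (R i)))
    (hCA : ∀ᶠ i in cofinite, (C i : Set (R i)) = A i) : IsOpen (box (A := A) C : Set (Πʳ i, [R i, A i])) := by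
  set T : Set ι := {i | ¬ ((C i : Set (R i)) = A i)} with hT
  have hTf : T.Finite := Filter.eventually_cofinite.1 hCA
  have h1 : IsOpen {f : Πʳ i, [R i, A i] | ∀ i, i ∉ T → f i ∈ (A i : Set (R i))} :=
    RestrictedProduct.isOpen_forall_imp_mem hAopen
  have h2 : IsOpen (⋂ i ∈ T, (fun f : Πʳ i, [R i, A i] => f i) ⁻¹' (C i : Set (R i))) :=
    hTf.isOpen_biInter fun i _ => (hCo i).preimage (RestrictedProduct.continuous_eval i)
  have hCi : ∀ i, i ∉ T → ∀ a : R i, a ∈ C i ↔ a ∈ A i := fun i hi a => by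
    have h : (C i : Set (R i)) = A i := not_not.1 hi
    rw [← SetLike.mem_coe, h, SetLike.mem_coe]
  convert h1.inter h2 using 1
  ext f
  simp only [SetLike.mem_coe, mem_box, Set.mem_inter_iff, Set.mem_setOf_eq, Set.mem_iInter, Set.mem_preimage]
  constructor
  · intro hf
    exact ⟨fun i hi => (hCi i hi _).1 (hf i), fun i _ => hf i⟩
  · rintro ⟨hA, hC⟩ i
    by_cases hi : i ∈ T
    · exact hC i hi
    · exact (hCi i hi _).2 (hA i hi)

omit [∀ i, SubringClass (S i) (R i)] hψ in
/-- **a box is compact** when every `C i` is compact and `C i = A i` for almost all `i`: it is the continuous image of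
the compact space `∏ i, C i` (through the principal restricted product over `{i ; C i = A i}`).
[cite: Weil1964, Chap. III n° 37] -/
theorem isCompact_box [∀ i, SubringClass (S i) (R i)] (C : ∀ i, AddSubgroup (R i))
    (hCc : ∀ i, IsCompact (C i : Set (R i))) (hCA : ∀ᶠ i in cofinite, (C i : Set (R i)) = A i) :
    IsCompact (box (A := A) C : Set (Πʳ i, [R i, A i])) := by
  set Sset : Set ι := {i | (C i : Set (R i)) = A i} with hSset
  have hS : cofinite ≤ 𝓟 Sset := Filter.le_principal_iff.2 hCA
  haveI : ∀ i, CompactSpace (C i) := fun i => isCompact_iff_compactSpace.1 (hCc i)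
  let g' : (Π i, C i) → Πʳ i, [R i, A i]_[𝓟 Sset] := fun c => ⟨fun i => (c i : R i), by
    rw [Filter.eventually_principal]
    intro i hi
    show (c i : R i) ∈ (A i : Set (R i))
    rw [← hi]
    exact (c i).2⟩
  have hg' : Continuous g' :=
    RestrictedProduct.continuous_rng_of_principal.2 (continuous_pi fun i => continuous_subtype_val.comp (continuous_apply i))
  have hg : Continuous (RestrictedProduct.inclusion R (fun i => (A i : Set (R i))) hS ∘ g') :=
    (RestrictedProduct.continuous_inclusion hS).comp hg'
  convert isCompact_range hg using 1
  ext x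
  simp only [SetLike.mem_coe, mem_box, Set.mem_range, Function.comp_apply]
  constructor
  · intro hx
    exact ⟨fun i => ⟨x i, hx i⟩, by ext i; rfl⟩
  · rintro ⟨c, rfl⟩ i
    exact (c i).2

end Topology

/-! ## §3 The dual lattice pair of boxes -/

section Pair

variable [∀ i, TopologicalSpace (R i)]

omit [∀ i, TopologicalSpace (R i)] hψ in
/-- an element supported at one place lies in a box iff its coordinate does. [cite: Weil1964, Chap. III n° 37] -/
theorem single_mem_box [DecidableEq ι] (C : ∀ i, AddSubgroup (R i)) (i : ι) {a : R i} (ha : a ∈ C i) :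
    RestrictedProduct.single A i a ∈ box (A := A) C := by
  rw [mem_box]
  intro j
  by_cases hj : j = i
  · subst hj
    rw [RestrictedProduct.single_eq_same A j a]
    exact ha
  · rw [RestrictedProduct.single_eq_of_ne A a hj]
    exact (C j).zero_mem

/-- **restricted products of rank-one dual lattice pairs**: if `(C₁ⁱ, C₂ⁱ)` is a dual lattice pair for
`(s, t) ↦ ψ_i(s t)` on `R i × R i` at every `i`, with `C₁ⁱ = A i = C₂ⁱ` for almost all `i`, then the boxes
`(∏ C₁ⁱ, ∏ C₂ⁱ)` form a dual lattice pair for `(x, y) ↦ (∏ψ)(x y)` on the restricted product — the adelic lattice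
`∏_v 𝒪_v × ∏_v 𝔠_v`. [cite: Weil1964, Chap. III n° 37–39] -/
theorem isDualLatticePair_box [DecidableEq ι] (hAopen : ∀ i, IsOpen (A i : Set (R i)))
    {C₁ C₂ : ∀ i, AddSubgroup (R i)} (hC : ∀ i, IsDualLatticePair (LinearMap.mul (R i) (R i)) (ψ i) (C₁ i) (C₂ i))
    (h₁ : ∀ᶠ i in cofinite, (C₁ i : Set (R i)) = A i) (h₂ : ∀ᶠ i in cofinite, (C₂ i : Set (R i)) = A i) :
    IsDualLatticePair (LinearMap.mul (Πʳ i, [R i, A i]) (Πʳ i, [R i, A i])) (prodChar ψ hψ) (box C₁) (box C₂) where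
  isCompact_left := isCompact_box C₁ (fun i => (hC i).isCompact_left) h₁
  isOpen_left := isOpen_box C₁ hAopen (fun i => (hC i).isOpen_left) h₁
  isCompact_right := isCompact_box C₂ (fun i => (hC i).isCompact_right) h₂
  isOpen_right := isOpen_box C₂ hAopen (fun i => (hC i).isOpen_right) h₂
  mem_right_iff y := by
    constructor
    · intro hy x hx
      rw [LinearMap.mul_apply']
      exact prodChar_eq_one_of_forall ψ hψ fun i => by
        rw [RestrictedProduct.mul_apply]
        exact (hC i).apply_eq_one (hx i) (hy i)
    · intro hy i
      rw [(hC i).mem_right_iff]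
      intro a ha
      have h1 := hy _ (single_mem_box C₁ i ha)
      rw [LinearMap.mul_apply', prodChar_eq_of_forall_ne ψ hψ i (fun j hj => by
        rw [RestrictedProduct.mul_apply, RestrictedProduct.single_eq_of_ne A a hj, zero_mul]),
        RestrictedProduct.mul_apply, RestrictedProduct.single_eq_same A i a] at h1
      exact h1
  mem_left_iff x := by
    constructor
    · intro hx y hy
      rw [LinearMap.mul_apply']
      exact prodChar_eq_one_of_forall ψ hψ fun i => by
        rw [RestrictedProduct.mul_apply]
        exact (hC i).apply_eq_one (hx i) (hy i)
    · intro hx i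
      rw [(hC i).mem_left_iff]
      intro b hb
      have h1 := hx _ (single_mem_box C₂ i hb)
      rw [LinearMap.mul_apply', prodChar_eq_of_forall_ne ψ hψ i (fun j hj => by
        rw [RestrictedProduct.mul_apply, RestrictedProduct.single_eq_of_ne A b hj, mul_zero]),
        RestrictedProduct.mul_apply, RestrictedProduct.single_eq_same A i b] at h1
      exact h1

end Pair

/-! ## §4 Unit scalings of boxes -/

section Scaling

variable [∀ i, TopologicalSpace (R i)]

omit hψ in
/-- **unit scalings of boxes shrink to `0`**: if at every `i` some unit scaling of `C i` lies in any given neighbourhood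
of `0`, and `C i = A i` for almost all `i`, then for every neighbourhood `N` of `0` in the restricted product some unit
`u` (equal to a suitable `u_i` at finitely many places and to `1` elsewhere) has `u · ∏ C i ⊆ N`.
[cite: Weil1964, Chap. III n° 37–39] -/
theorem exists_units_smul_box_subset (hAopen : ∀ i, IsOpen (A i : Set (R i))) (C : ∀ i, AddSubgroup (R i))
    (hCA : ∀ᶠ i in cofinite, (C i : Set (R i)) = A i)
    (hloc : ∀ i, ∀ V ∈ 𝓝 (0 : R i), ∃ u : (R i)ˣ, (u : R i) • (C i : Set (R i)) ⊆ V)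
    (N : Set (Πʳ i, [R i, A i])) (hN : N ∈ 𝓝 (0 : Πʳ i, [R i, A i])) :
    ∃ u : (Πʳ i, [R i, A i])ˣ,
      (((u : Πʳ i, [R i, A i]) • box (A := A) C : AddSubgroup (Πʳ i, [R i, A i])) : Set (Πʳ i, [R i, A i])) ⊆ N := by
  classical
  -- pull `N` back to a box neighbourhood of `0` in `∏ i, A i`
  set sM := RestrictedProduct.structureMap R (fun i => (A i : Set (R i))) cofinite with hsM
  have h0 : sM 0 = 0 := by ext i; rfl
  have hN' : sM ⁻¹' N ∈ 𝓝 (0 : Π i, A i) := by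
    have h := RestrictedProduct.nhds_zero_eq_map_structureMap (R := R) (B := A) hAopen
    rw [← hsM, h0] at h
    rw [h] at hN
    exact hN
  rw [nhds_pi, Filter.mem_pi'] at hN'
  obtain ⟨I, t, ht, hts⟩ := hN'
  have hV : ∀ i, ∃ V ∈ 𝓝 (0 : R i), Subtype.val ⁻¹' V ⊆ t i := fun i => (mem_nhds_subtype _ _ _).1 (ht i)
  choose V hV hVt using hV
  -- units: a suitable `u i` at the finitely many places `i ∈ I` or `C i ≠ A i`, `1` elsewhere
  have hu : ∀ i, ∃ u : (R i)ˣ, (u : R i) • (C i : Set (R i)) ⊆ V i ∩ A i :=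
    fun i => hloc i _ (Filter.inter_mem (hV i) ((hAopen i).mem_nhds (zero_mem (A i))))
  choose u hu using hu
  set J : Set ι := (↑I : Set ι) ∪ {i | ¬ ((C i : Set (R i)) = A i)} with hJ
  have hJf : J.Finite := I.finite_toSet.union (Filter.eventually_cofinite.1 hCA)
  let w : Π i, (R i)ˣ := fun i => if i ∈ J then u i else 1
  have hw : ∀ᶠ i in cofinite, w i ∈ (Submonoid.ofClass (A i)).units := by
    rw [Filter.eventually_cofinite]
    refine hJf.subset fun i hi => ?_
    by_contra hiJ
    apply hi
    show (if i ∈ J then u i else 1) ∈ (Submonoid.ofClass (A i)).units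
    rw [if_neg hiJ]
    exact Subgroup.one_mem _
  refine ⟨RestrictedProduct.mkUnit w hw, fun z hz => ?_⟩
  obtain ⟨x, hx, rfl⟩ := (AddSubgroup.mem_smul_pointwise_iff_exists _ _ _).1 hz
  have hwx : ∀ i, (w i : R i) * x i ∈ (A i : Set (R i)) ∧ (i ∈ J → (w i : R i) * x i ∈ V i) := by
    intro i
    by_cases hiJ : i ∈ J
    · have hmem : (u i : R i) * x i ∈ V i ∩ A i := hu i ⟨x i, hx i, rfl⟩
      have hwi : w i = u i := if_pos hiJ
      rw [hwi]
      exact ⟨hmem.2, fun _ => hmem.1⟩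
    · have hwi : w i = 1 := if_neg hiJ
      have hCi : (C i : Set (R i)) = A i := by
        by_contra hne
        exact hiJ (Or.inr hne)
      rw [hwi, Units.val_one, one_mul, ← hCi]
      exact ⟨hx i, fun h => absurd h hiJ⟩
  set c : Π i, A i := fun i => ⟨(w i : R i) * x i, (hwx i).1⟩ with hc
  have hcz : sM c = ((RestrictedProduct.mkUnit w hw : (Πʳ i, [R i, A i])ˣ) : Πʳ i, [R i, A i]) • x := by
    ext i
    rw [smul_eq_mul, RestrictedProduct.mul_apply]
    rfl
  rw [← hcz]
  refine hts ?_
  rw [Set.mem_pi]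
  intro i hi
  exact hVt i ((hwx i).2 (Or.inl hi))

end Scaling

end RestrictedPair

end Literature.RepresentationTheory.HeisenbergGroup

end
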